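import Summits.BirchSwinnertonDyer.BirchSwinnertonDyer.Theorems.SchneiderFreeAdditiveX3KrizLiHypothesisOneAutomatic
import Summits.BirchSwinnertonDyer.BirchSwinnertonDyer.Theorems.SchneiderFreeAdditiveX3SemistableTwistLocalNonAnomalous
import HarnessLib

/-!
# Kriz–Li 2019 Thm. 1.20, hypothesis (1) at the prime `p` itself, Galois side, on BOTH semistable-twist cells of the K1 door
# ((M): `V` multiplicative at `p`; (G-ord, `e = 2`): `V` good ordinary at `p`; `W = C • V^{(p*)}`, `p ≥ 5`): the isogeny character `r`
# of every rational `p`-line of `W[p]` and its partner `r⁻¹χ̄_p` are BOTH RAMIFIED at `p` (route `SchneiderFreeAdditiveX3`, Kriz–Li corner)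

Cell `bsd-schneider-ideate`, seat `bsd-schneider-door-c5` (prover, generation 37; `--supports` 19177 as helper).  PARTITION: board row
B6 ∩ X3 ∩ sst-twist, `r = 1`, BOTH cells at `p ≥ 5` (284 census pairs at `p = 5`, 23 at `p ∈ {7, 13}`, the `p = 37` row; class-wide) — the
KRIZ–LI SUB-LOCUS; types-the-object-of nothing new; closes none of B6's cells; BSD NOT advanced; «closes rung: none».  bears_on: K1-door (19177).

WHY.  The sibling `…KrizLiHypothesisOneAutomatic` (p745441) proved the inertia dichotomy `r|_{I_p} ∈ {ε, ε·χ̄_p}` on the (G-ord, `e = 2`)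
cell from Serre's ordinary line.  Generation 23's `…SemistableTwistLocalNonAnomalous` had already isolated the one local input both cells
share: an UNRAMIFIED-QUOTIENT LINE of `V[p]` at `I_𝔓` (`MixedCongruence.UnramifiedQuotientLineAt V p I_𝔓`: a line `L` with `(σ − 1)V[p] ⊆ L`,
on which inertia acts by `χ̄_p`, `MixedCongruence.smul_eq_cyclotomic_zsmul_of_forall_sub_mem`) — Serre's line for `V` good ordinary, the Tate
line for `V` multiplicative (X2's `exists_tateLine_adicCompletionPrime`, Tate uniformisation PROVED in the tree) — and derived from it the
DECOMPOSITION-group clause «`D_𝔓` neither fixes a rational line nor acts trivially on its quotient».  This file derives the sharper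
INERTIA-group statement that Kriz–Li's (1) needs in Dirichlet form (`p ∣ f(ψ)`, `p ∣ f(ψ⁻¹ω)`): both Jordan–Hölder characters along a rational
`p`-line are RAMIFIED at `p`, on both cells.

WHAT.
* §1 **`isogenyCharacter_dichotomy_of_twist_of_unramifiedQuotientLine`** — `W = C • V^{(d)}`, `I ≤ Γ_ℚ` any subgroup with an unramified-quotient
  line of `V[p]`, `⟨T⟩ ≤ W[p]` a rational line with character `r`: on `I` EITHER `r = ε` OR `r = ε·χ̄_p`, `ε(τ) = ±1` the sign of `τ` on `√d`
  (sign-equivariant twisting isomorphism `exists_signEquiv_of_twist`; the line `ℤ·e(T) ≤ V[p]` is `Γ_ℚ`-stable, so it IS the unramified-quotient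
  line — character `χ̄_p` — or meets it trivially — inertia acts trivially; scalars on a point of order `p` are read mod `p`,
  `KrizLiOneAutomatic.intCast_eq_intCast_of_zsmul_eq`).
* §2 **`exists_inertia_witnesses_of_pStar_twist_of_unramifiedQuotientLine`** — `d = p*`, `p ≥ 5`, ANY prime `𝔓 ∣ p` carrying an
  unramified-quotient line: `τ ∈ I_𝔓` with `r(τ) ≠ 1` and `τ′ ∈ I_𝔓` with `r(τ′) ≠ χ̄_p(τ′)` (the Kummer element `σ₁√p* = −√p*`,
  `exists_mem_inertia_smul_geomSqrt_eq_neg` with `ord_p(p*) = 1`; `χ̄_p(τ₂) = 2 ∉ {0, ±1}`, `exists_mem_inertia_modPCyclotomicCharacterZMod_eq`).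
* §3 **`exists_inertia_witnesses_of_classX3_of_subSemistableTwist`** — for `W` globally minimal with `ClassX3 W p`, `SubSemistableTwist W p`,
  `p ≥ 5`, and ANY rational `p`-line `⟨T⟩ ≤ W[p]` with character `r`: a place `v ∋ p`, a prime `𝔓 ∣ v` and the two witnesses ((M): X2's Tate
  line via `AdditivePotMult.PotMult.exists_mult_pStar_twist_model`; (G-ord): `ClassX3Gord.exists_goodOrd_pStar_twist_model` +
  `MixedCongruence.unramifiedQuotientLineAt_of_goodOrdinary`).  The sequel `…KrizLiHypothesisOneAutomaticDoor` turns this into hypothesis (1).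

HONEST FRAMING: UNCONDITIONAL tree theorems (no definition, no named fact, no `sorry`; Tate uniformisation enters through the tree's
discharged `…tateUniformisation_holds`); Galois-module statements only; nothing about BSD is proved; r2/r3 untouched; «closes rung: none».
References: [Serre1972] §1.11 Prop. 11, §1.12 Prop. 13; [SilvermanAEC2009] X.5 Cor. 5.4; [SilvermanATAEC1994] V.5.3–5.4; [Lang1983] Ch. 6
Prop. 1.3; [KrizLi2019] Thm. 1.20 (1) (p. 7); [Mazur1978] §5; this seat p745441, generation 23's `…SemistableTwistLocalNonAnomalous`.
-/

set_option autoImplicit false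
-- `Summit.<P>.<Sub>` repeats `BirchSwinnertonDyer` by the tree's layout convention (D-0017)
set_option linter.dupNamespace false

noncomputable section

open scoped Classical NumberField Pointwise

open WeierstrassCurve NumberField IsDedekindDomain IsDedekindDomain.HeightOneSpectrum Field
  Literature.NumberTheory.EllipticCurves Literature.NumberTheory.GaloisRepresentations
  Literature.NumberTheory.EllipticCurves.Rank1Residual
  Summit.BirchSwinnertonDyer.Rank1Residual Summit.BirchSwinnertonDyer.Rank1Residual.GaloisImage
  Summit.BirchSwinnertonDyer.Rank1Residual.Additive Summit.BirchSwinnertonDyer.Rank1Residual.AdditivePotMult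

namespace Summit.BirchSwinnertonDyer.BirchSwinnertonDyer.Theorems.SchneiderFreeAdditiveX3.KrizLiOneSemistableTwist

variable {V W : WeierstrassCurve ℚ} [V.IsElliptic] [W.IsElliptic] {p : ℕ} [hp : Fact p.Prime]

/-! ### §1 The dichotomy `r|_I ∈ {ε, ε·χ̄_p}` from an unramified-quotient line of the untwisted curve -/

/-- **The isogeny character of a rational `p`-line of a quadratic twist, on a subgroup carrying an unramified-quotient line of the untwisted
curve: `ε` or `ε·χ̄_p`.**  Let `W = C • V^{(d)}` (`d ≠ 0`), `I ≤ Γ_ℚ` a subgroup such that `V[p]` has a line `L` with `(σ − 1)V[p] ⊆ L` for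
`σ ∈ I` (`MixedCongruence.UnramifiedQuotientLineAt V p I`), and `⟨T⟩ ≤ W[p]` a `Γ_ℚ`-stable line with isogeny character `r` (`σT = r(σ)T`).
Then EITHER for every `τ ∈ I`: `r(τ) = 1` if `τ√d = √d` and `r(τ) = −1` otherwise, OR for every `τ ∈ I`: `r(τ) = χ̄_p(τ)` if `τ√d = √d` and
`r(τ) = −χ̄_p(τ)` otherwise.  Proof: along the sign-equivariant twisting isomorphism `e : W[p] ≃ V[p]` (`exists_signEquiv_of_twist`) the line
`ℤ·e(T)` is `Γ_ℚ`-stable; it equals `L` (where `I` acts by `χ̄_p`, `MixedCongruence.smul_eq_cyclotomic_zsmul_of_forall_sub_mem`) or meets it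
trivially (so `I` acts trivially on it); read back through `e`.
[cite: Serre1972, §1.11 Prop. 11 and §1.12 Prop. 13] [cite: SilvermanAEC2009, X.5 Cor. 5.4] [cite: Mazur1978, §5 (p. 148)] -/
theorem isogenyCharacter_dichotomy_of_twist_of_unramifiedQuotientLine {d : ℚ} (hd0 : d ≠ 0)
    (hCW : ∃ C : VariableChange ℚ, C • V.quadraticTwist d = W) (I : Subgroup (absoluteGaloisGroup ℚ))
    (hUQ : MixedCongruence.UnramifiedQuotientLineAt V p I)
    {T : geomTorsion W (p : ℤ)} (hT0 : T ≠ 0) {r : absoluteGaloisGroup ℚ →* (ZMod p)ˣ}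
    (hr : ∀ σ : absoluteGaloisGroup ℚ, σ • T = ((r σ : (ZMod p)ˣ) : ZMod p).val • T) :
    (∀ τ ∈ I,
        (τ • geomSqrt d = geomSqrt d → ((r τ : (ZMod p)ˣ) : ZMod p) = 1) ∧
        (¬ τ • geomSqrt d = geomSqrt d → ((r τ : (ZMod p)ˣ) : ZMod p) = -1)) ∨
    (∀ τ ∈ I,
        (τ • geomSqrt d = geomSqrt d →
          ((r τ : (ZMod p)ˣ) : ZMod p) = ((modNCyclotomicCharacter ℚ p τ : (ZMod p)ˣ) : ZMod p)) ∧
        (¬ τ • geomSqrt d = geomSqrt d →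
          ((r τ : (ZMod p)ˣ) : ZMod p) = -((modNCyclotomicCharacter ℚ p τ : (ZMod p)ˣ) : ZMod p))) := by
  have hpP : p.Prime := hp.out
  obtain ⟨C, hC⟩ := hCW
  have hC' : C⁻¹ • W = V.quadraticTwist d := by rw [← hC, inv_smul_smul]
  -- the sign-equivariant twisting isomorphism `e : W[p] ≃ V[p]`
  obtain ⟨e, hpos, hneg⟩ := exists_signEquiv_of_twist (W := V) (Wd := W) (p := p) hd0 C⁻¹ hC'
  set x : geomTorsion V (p : ℤ) := e T with hxdef
  have hx0 : x ≠ 0 := (AddEquiv.map_ne_zero_iff e).mpr hT0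
  have hrT : ∀ σ : absoluteGaloisGroup ℚ, σ • T = (((r σ : (ZMod p)ˣ) : ZMod p).val : ℤ) • T := by
    intro σ; rw [natCast_zsmul]; exact hr σ
  -- `ℤ x` is `Γ_ℚ`-stable
  have hstab : ∀ σ : absoluteGaloisGroup ℚ, σ • x ∈ AddSubgroup.zmultiples x := by
    intro σ
    by_cases hs : σ • geomSqrt d = geomSqrt d
    · refine ⟨(((r σ : (ZMod p)ˣ) : ZMod p).val : ℤ), ?_⟩
      change (((r σ : (ZMod p)ˣ) : ZMod p).val : ℤ) • x = σ • x
      rw [hxdef, ← hpos σ hs, hrT σ, map_zsmul]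
    · refine ⟨-(((r σ : (ZMod p)ˣ) : ZMod p).val : ℤ), ?_⟩
      change (-(((r σ : (ZMod p)ˣ) : ZMod p).val : ℤ)) • x = σ • x
      have h1 : σ • e T = -e (σ • T) := by rw [hneg σ hs, neg_neg]
      rw [hxdef, h1, hrT σ, map_zsmul, neg_zsmul]
  obtain ⟨L, hL, hLsub⟩ := hUQ
  have hcardx : Nat.card (AddSubgroup.zmultiples x) = p := by
    have hpx : p • x = 0 := Subtype.ext (by
      rw [AddSubgroupClass.coe_nsmul, ← natCast_zsmul]
      exact (mem_geomTorsion_iff V (p : ℤ) (x : geomPoints V)).mp x.2)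
    rw [Nat.card_zmultiples, addOrderOf_eq_prime hpx hx0]
  -- inertia acts on `x` trivially (off `L`) or through `χ̄_p` (on `L`)
  have key : (∀ τ ∈ I, τ • x = x) ∨
      (∀ τ ∈ I, τ • x = (((modNCyclotomicCharacter ℚ p τ : (ZMod p)ˣ) : ZMod p).val : ℤ) • x) := by
    rcases line_eq_or_inf_eq_bot hcardx hL with heq | hinf
    · right
      intro τ hτ
      have hxL : x ∈ L := heq ▸ AddSubgroup.mem_zmultiples x
      rw [← modPCyclotomicCharacterZMod_eq_modNCyclotomicCharacter]
      exact MixedCongruence.smul_eq_cyclotomic_zsmul_of_forall_sub_mem V p τ hL (hLsub τ hτ) hxL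
    · left
      intro τ hτ
      have h3 : τ • x - x ∈ AddSubgroup.zmultiples x ⊓ L :=
        ⟨AddSubgroup.sub_mem _ (hstab τ) (AddSubgroup.mem_zmultiples x), hLsub τ hτ x⟩
      rw [hinf, AddSubgroup.mem_bot] at h3
      exact sub_eq_zero.mp h3
  -- read back on `T = e⁻¹ x`
  have back : ∀ τ : absoluteGaloisGroup ℚ, ∀ m : ℤ, τ • x = m • x →
      (τ • geomSqrt d = geomSqrt d → ((r τ : (ZMod p)ˣ) : ZMod p) = (m : ZMod p)) ∧
      (¬ τ • geomSqrt d = geomSqrt d → ((r τ : (ZMod p)ˣ) : ZMod p) = -(m : ZMod p)) := by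
    intro τ m hm
    have hrval : (((((r τ : (ZMod p)ˣ) : ZMod p).val : ℤ)) : ZMod p) = ((r τ : (ZMod p)ˣ) : ZMod p) := by
      rw [Int.cast_natCast, ZMod.natCast_zmod_val]
    constructor
    · intro hτ
      have h1 : e ((((r τ : (ZMod p)ˣ) : ZMod p).val : ℤ) • T) = e (m • T) := by
        rw [← hrT τ, hpos τ hτ, ← hxdef, hm, map_zsmul]
      rw [← hrval]
      exact KrizLiOneAutomatic.intCast_eq_intCast_of_zsmul_eq hT0 (e.injective h1)
    · intro hτ
      have h1 : e ((((r τ : (ZMod p)ˣ) : ZMod p).val : ℤ) • T) = e ((-m) • T) := by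
        rw [← hrT τ, hneg τ hτ, ← hxdef, hm, map_zsmul, neg_zsmul]
      rw [← hrval, ← Int.cast_neg]
      exact KrizLiOneAutomatic.intCast_eq_intCast_of_zsmul_eq hT0 (e.injective h1)
  rcases key with hfix | hcyc
  · left
    intro τ hτ
    have h := back τ 1 (by rw [one_zsmul]; exact hfix τ hτ)
    simpa only [Int.cast_one] using h
  · right
    intro τ hτ
    have h := back τ _ (hcyc τ hτ)
    simpa only [Int.cast_natCast, ZMod.natCast_zmod_val] using h

/-! ### §2 The two inertia witnesses at `p` for `d = p*`, `p ≥ 5`, at ANY prime `𝔓 ∣ p` -/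

/-- **Both Jordan–Hölder characters along a rational `p`-line of `W = C • V^{(p*)}` are RAMIFIED at `p` (`p ≥ 5`), at any prime `𝔓 ∣ p`
where `V[p]` has an unramified-quotient line at `I_𝔓`:** there are `τ ∈ I_𝔓` with `r(τ) ≠ 1` and `τ′ ∈ I_𝔓` with `r(τ′) ≠ χ̄_p(τ′)`.
Witnesses: the Kummer element `σ₁ ∈ I_𝔓` with `σ₁√p* = −√p*` (`ord_p(p*) = 1`, `exists_mem_inertia_smul_geomSqrt_eq_neg`) and `τ₂ ∈ I_𝔓` with
`χ̄_p(τ₂) = 2` (`exists_mem_inertia_modPCyclotomicCharacterZMod_eq`); by §1 `r|_{I_𝔓} ∈ {ε, ε·χ̄_p}`, and `−1 ≠ 1`, `2 ∉ {±1}`, `−u ≠ u` in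
`𝔽_p` for `p ≥ 5`. [cite: Serre1972, §1.11–1.12] [cite: Lang1983, Ch. 6 Prop. 1.3] [cite: KrizLi2019, Thm. 1.20 hypothesis (1) (p. 7)] -/
theorem exists_inertia_witnesses_of_pStar_twist_of_unramifiedQuotientLine (hp5 : 5 ≤ p)
    (hCW : ∃ C : VariableChange ℚ, C • V.quadraticTwist ((-1 : ℚ) ^ (p / 2) * p) = W)
    {v : HeightOneSpectrum (𝓞 ℚ)} (hpv : ((p : ℕ) : 𝓞 ℚ) ∈ v.asIdeal)
    {𝔓 : Ideal (absIntegers (𝓞 ℚ) ℚ)} (h𝔓 : 𝔓 ∈ v.primesAbove)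
    (hUQ : MixedCongruence.UnramifiedQuotientLineAt V p (𝔓.inertia (absoluteGaloisGroup ℚ)))
    {T : geomTorsion W (p : ℤ)} (hT0 : T ≠ 0) {r : absoluteGaloisGroup ℚ →* (ZMod p)ˣ}
    (hr : ∀ σ : absoluteGaloisGroup ℚ, σ • T = ((r σ : (ZMod p)ˣ) : ZMod p).val • T) :
    (∃ τ ∈ 𝔓.inertia (absoluteGaloisGroup ℚ), r τ ≠ 1) ∧
      (∃ τ ∈ 𝔓.inertia (absoluteGaloisGroup ℚ),
        ((r τ : (ZMod p)ˣ) : ZMod p) ≠ ((modNCyclotomicCharacter ℚ p τ : (ZMod p)ˣ) : ZMod p)) := by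
  have hpP : p.Prime := hp.out
  have hp2 : p ≠ 2 := by omega
  have hp3 : p ≠ 3 := by omega
  haveI : NeZero p := ⟨hpP.ne_zero⟩
  set d : ℚ := (-1 : ℚ) ^ (p / 2) * p with hddef
  have hd0 : d ≠ 0 := mul_ne_zero (pow_ne_zero _ (by norm_num)) (by exact_mod_cast hpP.ne_zero)
  -- two facts in `𝔽_p`, `p ≥ 5`
  have hne2 : ∀ u : (ZMod p)ˣ, -(u : ZMod p) ≠ (u : ZMod p) := by
    intro u h
    have h2 : (2 : ZMod p) * (u : ZMod p) = 0 := by rw [two_mul]; nth_rewrite 1 [← h]; rw [neg_add_cancel]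
    rcases mul_eq_zero.mp h2 with h0 | h0
    · have : (p : ℤ) ∣ 2 := by
        rw [← ZMod.intCast_zmod_eq_zero_iff_dvd]; exact_mod_cast h0
      have h' : p ∣ 2 := by exact_mod_cast this
      exact hp2 ((Nat.prime_dvd_prime_iff_eq hpP Nat.prime_two).mp h')
    · exact u.ne_zero h0
  have h2ne : ((2 : ℕ) : ZMod p) ≠ 1 ∧ ((2 : ℕ) : ZMod p) ≠ -1 := by
    constructor
    · intro h
      have h1 : (((2 : ℕ) : ℤ) : ZMod p) = ((1 : ℤ) : ZMod p) := by exact_mod_cast h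
      rw [ZMod.intCast_eq_intCast_iff_dvd_sub] at h1
      have h3 : (p : ℤ) ∣ 1 := by simpa using h1.neg_right
      exact hpP.one_lt.ne' (Nat.dvd_one.mp (by exact_mod_cast h3))
    · intro h
      have h1 : (((2 : ℕ) : ℤ) : ZMod p) = ((-1 : ℤ) : ZMod p) := by exact_mod_cast h
      rw [ZMod.intCast_eq_intCast_iff_dvd_sub] at h1
      have h3 : (p : ℤ) ∣ 3 := by simpa using h1.neg_right
      have h4 : p ∣ 3 := by exact_mod_cast h3
      exact hp3 ((Nat.prime_dvd_prime_iff_eq hpP Nat.prime_three).mp h4)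
  -- the Kummer element `σ₁ ∈ I_𝔓`: `σ₁ √p* = −√p*`
  have h2v : (2 : 𝓞 ℚ) ∉ v.asIdeal := two_not_mem_of_natCast_prime_mem hpP hp2 hpv
  obtain ⟨σm, hσmI, hσm⟩ := exists_mem_inertia_smul_geomSqrt_eq_neg (E := ℚ) (intValuation_pStar p hpv) h2v h𝔓
  have hcoe : ((((-1 : ℤ) ^ (p / 2) * p : ℤ) : 𝓞 ℚ) : ℚ) = d := by
    rw [RingOfIntegers.coe_eq_algebraMap, map_intCast, hddef]; push_cast; ring
  rw [hcoe] at hσm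
  have hσmne : ¬ σm • geomSqrt d = geomSqrt d := by
    rw [hσm]; intro h; exact geomSqrt_ne_zero hd0 (neg_eq_self.mp h)
  -- the cyclotomic element `τ₂ ∈ I_𝔓`: `χ̄_p(τ₂) = 2`
  have hcop : Nat.Coprime 2 p := (Nat.coprime_primes Nat.prime_two hpP).mpr hp2.symm
  obtain ⟨τt, hτtI, hτtχ⟩ := exists_mem_inertia_modPCyclotomicCharacterZMod_eq p hpv h𝔓 (ZMod.unitOfCoprime 2 hcop)
  have hχt : ((modNCyclotomicCharacter ℚ p τt : (ZMod p)ˣ) : ZMod p) = ((2 : ℕ) : ZMod p) := by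
    rw [← modPCyclotomicCharacterZMod_eq_modNCyclotomicCharacter, hτtχ, ZMod.coe_unitOfCoprime]
  rcases isogenyCharacter_dichotomy_of_twist_of_unramifiedQuotientLine hd0 hCW _ hUQ hT0 hr with hA | hB
  · -- Case A: `r = ε` on `I_𝔓`
    refine ⟨⟨σm, hσmI, fun h1 => ?_⟩, ⟨τt, hτtI, fun h => ?_⟩⟩
    · have h := (hA σm hσmI).2 hσmne
      rw [h1, Units.val_one] at h
      exact hne2 1 (by rw [Units.val_one]; exact h.symm)
    · by_cases hs : τt • geomSqrt d = geomSqrt d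
      · rw [(hA τt hτtI).1 hs, hχt] at h; exact h2ne.1 h.symm
      · rw [(hA τt hτtI).2 hs, hχt] at h; exact h2ne.2 h.symm
  · -- Case B: `r = ε · χ̄_p` on `I_𝔓`
    refine ⟨⟨τt, hτtI, fun h1 => ?_⟩, ⟨σm, hσmI, fun h => ?_⟩⟩
    · by_cases hs : τt • geomSqrt d = geomSqrt d
      · have h := (hB τt hτtI).1 hs
        rw [h1, Units.val_one, hχt] at h; exact h2ne.1 h.symm
      · have h := (hB τt hτtI).2 hs
        rw [h1, Units.val_one, hχt] at h
        apply h2ne.2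
        rw [← neg_neg ((2 : ℕ) : ZMod p), ← h]
    · rw [(hB σm hσmI).2 hσmne] at h
      exact hne2 _ h

/-! ### §3 The semistable-twist cells of the door: both Jordan–Hölder characters are ramified at `p` (`p ≥ 5`) -/

variable (W) [W.IsGloballyMinimal]

/-- **On the semistable-twist cells of the K1 door at `p ≥ 5`, both Jordan–Hölder characters along ANY rational `p`-line are ramified at
`p`.**  For `W/ℚ` globally minimal with `ClassX3 W p` and `SubSemistableTwist W p` (`= SubM ∨ SubGordTwo`), `p ≥ 5`, and a `Γ_ℚ`-stable line
`⟨T⟩ ≤ W[p]` with isogeny character `r`: there are a place `v ∋ p` of `ℚ`, a prime `𝔓 ∣ v` of `\bar ℤ`, and `τ, τ′ ∈ I_𝔓` with `r(τ) ≠ 1`,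
`r(τ′) ≠ χ̄_p(τ′)`.  (M): `W = C • V^{(p*)}` with `V` multiplicative at `p` (`PotMult.exists_mult_pStar_twist_model`) and X2's Tate line at the
chosen prime above `p` (`exists_tateLine_adicCompletionPrime`, Tate uniformisation discharged in the tree); (G-ord, `e = 2`): `V` good ordinary
(`ClassX3Gord.exists_goodOrd_pStar_twist_model`) and Serre's line (`MixedCongruence.unramifiedQuotientLineAt_of_goodOrdinary`); then §2.
[cite: Serre1972, §1.11 Prop. 11, §1.12 Prop. 13] [cite: SilvermanATAEC1994, Ch. V Thm. 5.3, Cor. 5.4] [cite: SilvermanAEC2009, X.5 Cor. 5.4] -/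
theorem exists_inertia_witnesses_of_classX3_of_subSemistableTwist (hp5 : 5 ≤ p) (hX : ClassX3 W p)
    (hS : SubSemistableTwist W p)
    {T : geomTorsion W (p : ℤ)} (hT0 : T ≠ 0) {r : absoluteGaloisGroup ℚ →* (ZMod p)ˣ}
    (hr : ∀ σ : absoluteGaloisGroup ℚ, σ • T = ((r σ : (ZMod p)ˣ) : ZMod p).val • T) :
    ∃ (v : HeightOneSpectrum (𝓞 ℚ)), Rat.HeightOneSpectrum.natGenerator v = p ∧
      ∃ 𝔓 ∈ v.primesAbove,
        (∃ τ ∈ 𝔓.inertia (absoluteGaloisGroup ℚ), r τ ≠ 1) ∧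
        (∃ τ ∈ 𝔓.inertia (absoluteGaloisGroup ℚ),
          ((r τ : (ZMod p)ˣ) : ZMod p) ≠ ((modNCyclotomicCharacter ℚ p τ : (ZMod p)ˣ) : ZMod p)) := by
  have hpP : p.Prime := hp.out
  have hp2 : p ≠ 2 := by omega
  rcases hS with hSM | hSG
  · -- (M): `W = C • V^{(p*)}`, `V` multiplicative at `p`; the Tate line at the chosen prime above `p`
    have hpm : AdditivePotMult.PotMult W p := ⟨hX.2, hSM⟩
    obtain ⟨V, _, _, C, hV, hC⟩ := hpm.exists_mult_pStar_twist_model hp2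
    obtain ⟨v, hv, 𝔓, h𝔓, L, hL, hLsub, -⟩ :=
      X2.IsogenyLineType.exists_tateLine_adicCompletionPrime V p
        TateCurve.Silverman1994_thmV53_tateUniformisation_holds
        TateCurve.Silverman1994_thmV53_corV54_tateUniformisation_holds hp2 hV
    exact ⟨v, Rat.natGenerator_eq_of_prime_mem v hpP hv, 𝔓, h𝔓,
      exists_inertia_witnesses_of_pStar_twist_of_unramifiedQuotientLine hp5 ⟨C, hC⟩ hv h𝔓 ⟨L, hL, hLsub⟩ hT0 hr⟩
  · -- (G-ord, `e = 2`): `W = C • V^{(p*)}`, `V` good ordinary at `p`; Serre's line at any prime above `p`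
    have hXG : ClassX3Gord W p := (classX3Gord_iff_subGord W p hp2 hX).mpr hSG.1
    obtain ⟨V, _, _, C, hV, hC⟩ := ClassX3Gord.exists_goodOrd_pStar_twist_model W p hp2 hXG hSG.2
    obtain ⟨v, hv⟩ := Literature.NumberTheory.NumberFields.RingOfIntegers.exists_heightOneSpectrum_natCast_mem ℚ hpP
    refine ⟨v, Rat.natGenerator_eq_of_prime_mem v hpP hv, adicCompletionPrime ℚ v, adicCompletionPrime_mem_primesAbove ℚ v, ?_⟩
    exact exists_inertia_witnesses_of_pStar_twist_of_unramifiedQuotientLine hp5 ⟨C, hC⟩ hv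
      (adicCompletionPrime_mem_primesAbove ℚ v)
      (MixedCongruence.unramifiedQuotientLineAt_of_goodOrdinary hp2 hV.1 hV.2 hv (adicCompletionPrime_mem_primesAbove ℚ v))
      hT0 hr

end Summit.BirchSwinnertonDyer.BirchSwinnertonDyer.Theorems.SchneiderFreeAdditiveX3.KrizLiOneSemistableTwist

end
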